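import Literature.MathematicalPhysics.QuantumFieldTheory.Balaban1983to89.B8Eq131Derivation
import Literature.MathematicalPhysics.QuantumFieldTheory.Balaban1983to89.B7Prop4GeneralLevels
import Literature.MathematicalPhysics.QuantumFieldTheory.Balaban1983to89.B7BlockAvgLog
import Literature.MathematicalPhysics.QuantumFieldTheory.Balaban1983to89.B8Ineq145
import Literature.MathematicalPhysics.QuantumFieldTheory.Balaban1983to89.B8Prop6OfThm4

/-!
# `Balaban1983to89.B8Ineq145Lineage` — [Balaban1985RegularSpaces] Prop. 7, display (1.145) p. 100: the located failure
# (cell GAPS G-B8-01) of «|(U′U₀)‾ʲ − Ū₀ʲ| = |exp iQ_j(U₀, ηA) − 1| < 2α₂» on CROSSING bonds, re-derived ON THE LINEAGE'S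
# CONCRETE `ℤᵈ` CARRIERS (the averaging operations of [3] as formalised in `B7Prop2Explicit`/`B7Eq92Concrete`/
# `B7Eq84Concrete`, and B8's typed gauge classes `B8Eq119TwistedAxial.InAx`/`Restr129`)

statement-level skeleton of published theorems with citation tags; proofs where landed; nothing here is a claim about the Yang–Mills mass gap

CITATION HEADER.  T. Bałaban, *Spaces of regular gauge field configurations on a lattice and gauge fixing conditions*,
Commun. Math. Phys. **99** (1985) 75–102 [Balaban1985RegularSpaces] ("B8"; PDF held `paper:balaban1985-cmp99-regular-
spaces-gauge-fixing`, journal page = PDF page + 74); "[3]" = T. Bałaban, *Averaging operations for lattice gauge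
theories*, Commun. Math. Phys. **98** (1985) 17–51 [Balaban1985Averaging] ("B7").  Unit `lit-balaban-r05` gen 6 (B8 fold
owner; HOME `run/shared/lean/pub/lit-balaban/`; SKELETON row **B8.Prop7**, GAPS **G-B8-01**), 2026-08-21.

WHAT IS PRINTED (p. 100 [PDF 26], verbatim).  *"We consider the configuration U₁U₀, U₁ = e^{iηA}."* … **Proposition 7.**
*"If the configurations U₀, A satisfy (1.139), (1.140), then for α₀, α₂ sufficiently small we have
U′U₀ = (U₁U₀)^u ∈ 𝔄_k({Ω_j}, α₀ + 3α₂) ∩ Ax_k(𝔅_k, U₀), (1.144)  |(U′U₀)‾ʲ − Ū₀ʲ| = |exp iQ_j(U₀, ηA) − 1| < 2α₂ on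
Ω_j^{(j)}. (1.145)"*, with (1.139) *"U₀ ∈ 𝔄_k({Ω_j}, α₀)"*, (1.140) *"L^jη|A|, (L^jη)²|∇^η_{U₀}A|, (L^jη)³|D^{η*}_{U₀}D^η_{U₀}A|
< α₂ on Ω_j"*, (1.143) *"|Q_j(U₀, ηA)| < 2α₂ on Ω_j^{(j)}"*, `u` the gauge transformation restricted by (1.29) p. 81
*"(\overline{R₀u}ʲ)(y) = 1 for y ∈ Λ_j, j = 0, 1, …, k"* which puts `U′U₀ = (U₁U₀)^u` into the axial gauge (1.19) p. 79
relative to `U₀` (p. 81: *"In [3] we have determined the gauge transformation u in terms of the configuration U₁"*;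
p. 78: u = 1 on Λ₀ is (1.14)).  The bond set "on Ω_j^{(j)}" / "on Λ_j" follows the convention of p. 77: *"we denote by
Ω also the set of bonds ⋃_{x∈Ω} st(x) = {bonds b ⊂ T: at least one end-point of b belongs to Ω}"*; the CROSSING bonds
`b₋ ∈ Λ_{j−1}`, `b₊ ∈ Λ_j` are exactly the bonds of the second line of (1.31) p. 82, on which Theorem 2 consumes (1.35).

WHAT THE CELL HAD (GAPS G-B8-01, pre-Phase-2 finding G-adv8-16, owner-adjudicated «constants only»).  On a crossing bond
the laws (97), (99), (87), (105) of [3] that p. 81 invokes give `Ũ′ʲ_b = \overline{R̄^{j−1}_{0,b₋}Ū₁^{j−1}}·(Ū₁ʲ)_b` (the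
paper's own second line of (1.31)), so the EQUALITY of (1.145) holds iff the block factor is `1`, and the INEQUALITY
holds only with a constant `C(d, L)·α₂` (`B8Ineq145.LevelData.*`, abstract carriers; `B8Ineq145Flat.*`, a separate
`U(1)` transcription of the printed formulas with `printed_145_fails_on_tower`).  G-B8-01 records: *"No `¬ Prop7Printed`
theorem on a concrete lattice model exists (that needs the B7 averages as a model)"*.

WHAT THIS MODULE PROVES (all `theorem`s; axioms standard).  The same witness, but for THE LINEAGE'S OWN OBJECTS — the
ones in which rows B8.Eq1.31 (`B8Eq131Derivation`), B8.Eq1.56 (`B8Eq156Prop4`), B8.Eq1.79 (`B8Eq178Averages`) are certified: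
`(U′U₀)‾ʲ = B7Prop2Explicit.avgIter L (U′ * U₀) j` ((15)/(43) of [3]), `Ũ′ʲ = B7Eq92Concrete.tildIter` ((69)),
`U̿₁ʲ = B7Eq92Concrete.dbavgCovIter` ((90)–(92)) with `exp iQ_j(U₀, ηA) = U̿₁ʲ` (`B7Prop4GeneralLevels.logCovIter`, (127)/
(136)), `U′ = B7Eq92Concrete.mgauge U₀ u U₁` ((55) = (1.17), `B8Eq131Derivation.eq117_eq_mgauge`), the classes (1.19)
`B8Eq119TwistedAxial.InAx` and (1.29) `B8Eq119TwistedAxial.Restr129`.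
§1  Parallel transport of a CONSTANT configuration `V ≡ c` in any group: `V(Γ) = c^{n(Γ)}`, `n` = forward minus backward
    letters (`hol_cst`); `n(Γ_{y,y+r}) = Σ r_κ` for the block contours, `n(Γ_{c,x} ∪ (−Γ_c)) = 0`; hence the average (42)
    of [3] of a constant configuration is the constant `c^L` EXACTLY (`bavg_cst`: the closed-loop arguments of `log` are
    all `1`) and `Ūʲ ≡ c^{L^j}` (`avgIter_cst`) — no smallness, no commutativity.
§2  The flat abelian scalar model `𝔸 = ℂ`, `U₀ = 1`, `U₁ ≡ e^{iθ}`: the block frame (82)/(110) `\overline{R_{0,y}U₁} =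
    exp(iθ·d(L−1)/2)` (`vframe_cst`, mean staircase length `B8Ineq145.stairMean d L = d(L−1)/2`, under
    `d(L−1)|θ| < ln 2` so that every `log` of (110) is the series logarithm of the tree, `B7BlockAvgLog.mlog_exp`), the
    double-bar average (89)/(90) `U̿₁ʲ ≡ e^{iL^jθ}` (`dbavg_cst`, `dbavgIter_cst`), and `exp iQ₁(1, ηA) = e^{iLθ}`
    (`logIter_one_cst`, `exp_logCovIter_one_cst`).
§3  B8's geometry with `k = 1`, `Ω₀ = ℤᵈ`, `Λ₁ = Ω₁^{(1)} = {z : 0 ≤ z₀}`, `Λ₀ = {x : x₀ < 0}` (`= ℤᵈ ∖ B(Λ₁)`, (1.5)/(1.6))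
    and B8's gauge fixing `u₈` (`= 1` on `Λ₀`, (1.14)/(1.29)₀; `=` the gauge fixing `B7Eq84Concrete.glev` of [3] (76)–(87)
    on the blocks under `Λ₁`): PROVED `Restr129 L 1 Λ U₀ u₈` ((1.29)) and `InAx L 1 Λ U₀ (U′U₀)` ((1.19), i.e. the
    `Ax_k(𝔅_k, U₀)` clause of (1.144)) for EVERY `U₀`, `U₁`, every Banach algebra — `restr129_u8`, `inAx_u8`.
§4  On the crossing bonds `b = ⟨y, y + e_{i₀}⟩`, `y_{i₀} = −1` (`b₊ ∈ Λ₁`, `B(b₋) ⊂ Λ₀`), by r05 g5's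
    `B8Eq131Derivation.eq130_crossing` (p. 81: *"the formulas (97), (99), and (87) of [3] imply (Ũ₁^{u j})_b =
    \overline{R̄^{j−1}_{0,b₋}Ū₁^{j−1}}(Ū₁ʲ)_b"*) with its two (87)-hypotheses discharged by the definition of `u₈`:
    `Ũ′¹_b = \overline{R_{0,b₋}U₁}·(U̿₁¹)_b` for EVERY `U₀`, `U₁` (`tildIter_u8_crossing`, `avgIter_u8_crossing`) — the
    dictionary-free form of `B8Ineq145.LevelData.crossing`.
§5  THE WITNESS (`𝔸 = ℂ`, `U₀ = 1`, `U₁ ≡ e^{iθ}`): `Ũ′¹_b = e^{iθ(d(L−1)/2 + L)}` (`tildIter_crossing_cst`), the two members of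
    (1.145) in closed form `norm_lhs145_crossing` / `norm_rhs145` (
    `2|sin(flatRatio d L·Lθ/2)|` vs `2|sin(Lθ/2)|`, `flatRatio = 1 + d(L−1)/(2L)`); **`eq145_fails_lineage`** (the displayed
    EQUALITY fails on the crossing bond: `d = 4`, `L = 3`, every `0 < α₂ ≤ 1/4`, `Lθ = (27/28)α₂`);
    **`ineq145_fails_lineage`** (the displayed INEQUALITY fails there: `2α₂ < |(U′U₀)‾¹_b − Ū₀¹_b|`, by
    `B8Ineq145.flat_witness_exceeds`: `2 sin((9/8)α₂) > 2α₂`), both UNDER the printed hypotheses made concrete: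
    (1.139) for `U₀ = 1` (every plaquette variable is `1`), (1.140) `L^j·|ηA| = L^j|θ| < α₂` for `j = 0, 1` with all
    covariant derivatives of the constant `A` at the flat background equal to `0`, (1.143) `|Q₁(U₀, ηA)| = L|θ| < 2α₂`,
    and the gauge conditions of (1.144) (§3; `hyp139`, `hyp140_abs/grad/lap`, `hyp143`, `hyp144_inAk`);
    **`prop7_display145_refuted`** packages the witness as one existential statement over the lineage carriers.
§6  **`not_prop7Printed_lineage : ¬ B8.Prop7Printed (fun _ : Unit => lineageGF7) toAxial7`** — the r1-typed sentence of
    SKELETON row B8.Prop7 REFUTED for the `B8.GFData` packaging `lineageGF7` of this model (model instance; the four fields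
    `Prop7Printed` reads are the lineage's concrete predicates, `toAxial7 U₀ U₁ = U₁^{u₈}`; see the §6 banner for the
    faithfulness bookkeeping).
HONEST SCOPE.  (i) One explicit witness family (flat abelian, scalar `𝔸 = ℂ`, i.e. all variables in one maximal torus —
admissible: [3] p. 18 «with values in a Lie subgroup G of a unitary group U(N)»); the located failure is the block factor
`\overline{R_{0,b₋}U₁} ≠ 1`, exactly G-B8-01 (b).  (ii) What HOLDS instead is unchanged and already in the tree:
`B8Ineq145.LevelData.dist_crossing_le_const` (|Ũ′ʲ_b − 1| < C(d,L)α₂), `B8Ineq145.Prop7RepairedC`/`thm2_after_prop7RepairedC`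
— the paper downstream is unaffected (constants only).  (iii) The `𝔄_k(α₀ + 3α₂)` clause of (1.144) is not re-derived here
(for the witness all plaquette variables of `U′U₀` equal `1`; not needed for the refutation of (1.145)).  (iv) "(1.145) on
Ω_j^{(j)}" ⊇ "on Λ_j" ⊇ the crossing bonds `b₊ ∈ Λ_j` by the p. 77 bond convention and (1.31) line 2; on the MIRRORED
crossing bonds (`b₋ ∈ Λ_j`, `b₊ ∈ Λ_{j−1}`) the same block factor enters inverted (`B8Eq131Derivation.eq130_crossing_mirrored`),
the equality fails likewise and the modulus shrinks — not typed here.  (v) Nothing here is progress on `Summit.QuantumFields`;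
value = the G-B8-01 certificate now sits on the lineage's carriers (the GAPS sentence quoted above is discharged).

[cite: Balaban1985RegularSpaces, Prop. 7 (1.144)–(1.145) p.100, (1.139)–(1.140) p.100, (1.143) p.100, (1.29)–(1.31) pp.81–82,
(1.19) p.79, (1.14) p.78, p.77 (bond convention); Balaban1985Averaging, (8)–(9) p.18, (14)–(15) p.19, (42)–(43) pp.23–24,
(55)–(58) p.27, (76)–(87) pp.29–31, (89)–(92) p.31, (97)/(99) p.32, (105) p.33, (110) p.34, (127) p.37]
-/

noncomputable section

open NormedSpace Finset

namespace Literature.MathematicalPhysics.QuantumFieldTheory.Balaban1983to89.B8Ineq145Lineage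

open B7Prop1Explicit B7Prop2Explicit MatrixLog B7Eq92Concrete B7Eq99Concrete B7Eq84Concrete B7AvgGaugeCovariance
open B7Prop3Flat (Favg vframe dbavg expCfg)
open B7Prop4Flat (dbavgIter logIter expUnit_mlog dbavgIter_succ dbavgIter_zero logIter_succ logIter_zero)
open B7Prop4GeneralLevels (logCovIter logCovIter_one_left)
open B8Ineq130 (fl hol_one)
open B8Ineq132 (InAk CondAt plaqF covDiv covDeriv covDerivFwd plaqF_gaugeAct covDiv_gaugeAct)
open B7Eq78Linearization (conjR conjR_apply conjR_one)
open B8Prop6OfThm4 (one_inAk)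
open B8Eq119TwistedAxial (Restr129 InAx)
open B8Eq178Averages (restr129_iff_uavg)
open B8Eq131Derivation (eq130_crossing ax119_iff_ax67 under_zero_iff)
open B8Ineq145 (stairMean stairMean_eq flatRatio flat_witness_exceeds)

-- `Site` alone would resolve to the torus sites of `Setup.lean`; re-export the `ℤ^d` sites of `B7Prop1Explicit`.
export B7Prop1Explicit (Site)

variable {d : ℕ}

/-! ## §1 Parallel transport and averages of a CONSTANT configuration (any group / any Banach algebra) -/

section Constant

variable {G : Type*}

/-- The constant configuration `V(x, x + e_κ) ≡ c`. [folklore] -/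
def cst (c : G) : Site d → Fin d → G := fun _ _ => c

/-- `cst_apply`. [folklore] -/
@[simp] private theorem cst_apply (c : G) (x : Site d) (κ : Fin d) : cst c x κ = c := rfl

/-- The signed letter count of a word: `+1` per positively oriented bond, `−1` per negatively oriented one
((9) of [3]: `U(−b) = U(b)⁻¹`). [cite: Balaban1985Averaging, (9) p.18] -/
def zc (w : List (Letter d)) : ℤ := (w.map fun l => if l.2 then (1 : ℤ) else -1).sum

/-- `zc_nil`. [folklore] -/
@[simp] private theorem zc_nil : zc ([] : List (Letter d)) = 0 := rfl

/-- `zc_cons`. [folklore] -/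
@[simp] private theorem zc_cons (l : Letter d) (w : List (Letter d)) :
    zc (l :: w) = (if l.2 then (1 : ℤ) else -1) + zc w := by
  simp [zc]

/-- `zc_append`. [folklore] -/
@[simp] private theorem zc_append (w₁ w₂ : List (Letter d)) : zc (w₁ ++ w₂) = zc w₁ + zc w₂ := by
  simp [zc, List.sum_append]

/-- `zc_replicate_true`. [folklore] -/
@[simp] private theorem zc_replicate_true (n : ℕ) (κ : Fin d) : zc (List.replicate n ((κ, true) : Letter d)) = n := by
  induction n with
  | zero => rfl
  | succ n ih =>
    rw [List.replicate_succ, zc_cons, ih]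
    simp only [if_true, Nat.cast_succ]
    ring

/-- `zc_replicate_false`. [folklore] -/
@[simp] private theorem zc_replicate_false (n : ℕ) (κ : Fin d) : zc (List.replicate n ((κ, false) : Letter d)) = -n := by
  induction n with
  | zero => simp
  | succ n ih =>
    rw [List.replicate_succ, zc_cons, ih]
    simp only [Bool.false_eq_true, if_false, Nat.cast_succ]
    ring

/-- `zc (seg κ n) = n` (straight segments, backwards for `n < 0`). [cite: Balaban1985Averaging, p.20] -/
@[simp] theorem zc_seg (κ : Fin d) (n : ℤ) : zc (seg κ n) = n := by
  rcases Int.eq_nat_or_neg n with ⟨m, rfl | rfl⟩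
  · rw [seg_natCast, zc_replicate_true]
  · rw [seg_neg_natCast, zc_replicate_false]

/-- `zc (−Γ) = −zc Γ`. [cite: Balaban1985Averaging, (9) p.18] -/
@[simp] theorem zc_revWord (w : List (Letter d)) : zc (revWord w) = -zc w := by
  induction w with
  | nil => simp
  | cons l w ih =>
    rw [revWord_cons, zc_append, ih, zc_cons, zc_cons, zc_nil]
    obtain ⟨μ, b⟩ := l
    cases b <;> simp

/-- `zc` of a concatenation of segments. [folklore] -/
private theorem zc_flatMap_seg (l : List (Fin d)) (v : Site d) : zc (l.flatMap fun κ => seg κ (v κ)) = (l.map v).sum := by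
  induction l with
  | nil => simp [zc]
  | cons κ l ih => rw [List.flatMap_cons, zc_append, ih, zc_seg, List.map_cons, List.sum_cons]

/-- `zc (Γ_{y, y+v}) = Σ_κ v_κ` for the tree contours (B5 (1.7)). [cite: Balaban1985Averaging, p.24] -/
theorem zc_treeWord (v : Site d) : zc (treeWord v) = ∑ κ, v κ := by
  rw [treeWord, zc_flatMap_seg, List.map_reverse, List.sum_reverse, Fin.sum_univ_def]

variable [Group G]

/-- **(9) for a constant configuration**: `V(Γ) = c^{zc Γ}`. [cite: Balaban1985Averaging, (9) p.18] -/
theorem hol_cst (c : G) : ∀ (x : Site d) (w : List (Letter d)), hol (cst c) x w = c ^ zc w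
  | x, [] => by simp
  | x, l :: w => by
    rw [hol_cons, hol_cst c (x + l.vec) w, zc_cons, zpow_add]
    obtain ⟨μ, b⟩ := l
    cases b
    · simp [stepHol_false]
    · simp [stepHol_true]

omit [Group G] in
/-- `zc` of the contour `Γ_{c,x}` (14) of [3] is `L`. [cite: Balaban1985Averaging, (14) p.19] -/
theorem zc_gammaWord (L : ℕ) (κ : Fin d) (r : Site d) : zc (gammaWord L κ r) = L := by
  rw [gammaWord, zc_append, zc_append, zc_revWord, zc_seg]
  ring

end Constant

section ConstantAverage

variable {𝔸 : Type*} [NormedRing 𝔸] [NormedAlgebra ℂ 𝔸] [CompleteSpace 𝔸]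

omit [NormedAlgebra ℂ 𝔸] [CompleteSpace 𝔸] in
/-- **The arguments of `log` in (42) are all `1` for a constant configuration**: `V(Γ_{c,x})V(c)⁻¹ = c^L(c^L)⁻¹ = 1`.
[cite: Balaban1985Averaging, (42) p.23] -/
theorem Wcx_cst (L : ℕ) (c : 𝔸ˣ) (q : Site d) (κ : Fin d) (r : Site d) : Wcx L (cst c) q κ r = 1 := by
  rw [Wcx, hol_cst, hol_cst, zc_gammaWord, zc_seg, mul_inv_cancel]

omit [CompleteSpace 𝔸] in
/-- Hence the exponent `X_c` of (42) vanishes. [cite: Balaban1985Averaging, (42) p.23] -/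
theorem Xavg_cst (L : ℕ) (c : 𝔸ˣ) (q : Site d) (κ : Fin d) : Xavg L (cst c) q κ = 0 := by
  simp [Xavg, Wcx_cst]

/-- **(42) of [3] on a constant configuration is EXACT**: `V̄_c = c^L` (no smallness, no commutativity).
[cite: Balaban1985Averaging, (42) p.23] -/
theorem bavg_cst (L : ℕ) (c : 𝔸ˣ) : bavg L (cst c : Site d → Fin d → 𝔸ˣ) = cst (c ^ L) := by
  funext q κ
  rw [bavg, Xavg_cst, B7Prop8Flat.expUnit_zero, one_mul, hol_cst, zc_seg, zpow_natCast, cst_apply]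

/-- **(43) of [3] on a constant configuration**: `Ūʲ ≡ c^{L^j}`. [cite: Balaban1985Averaging, (43) p.24] -/
theorem avgIter_cst (L : ℕ) (c : 𝔸ˣ) : ∀ j : ℕ, avgIter L (cst c : Site d → Fin d → 𝔸ˣ) j = cst (c ^ L ^ j)
  | 0 => by simp
  | j + 1 => by
    rw [avgIter_succ, avgIter_cst L c j, bavg_cst, ← pow_mul, ← pow_succ]
    rfl

end ConstantAverage

/-! ## §2 The flat abelian scalar model `𝔸 = ℂ`: `U₀ = 1`, `U₁ ≡ e^{iθ}` -/

section Scalar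

open Complex (I)

/-- `e^{iθ}` as a unit of `ℂ`, through the tree's `expUnit` (so that `(eI θ : ℂ) = exp (iθ)` with the Banach-algebra
exponential of the lineage). [folklore] -/
def eI (θ : ℝ) : ℂˣ := expUnit (I * (θ : ℂ))

/-- `val_eI`. [folklore] -/
@[simp] private theorem val_eI (θ : ℝ) : ((eI θ : ℂˣ) : ℂ) = exp (I * (θ : ℂ)) := rfl

/-- `val_eI_complex`: the same with `Complex.exp`. [folklore] -/
private theorem val_eI_complex (θ : ℝ) : ((eI θ : ℂˣ) : ℂ) = Complex.exp (I * (θ : ℂ)) := by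
  rw [val_eI, Complex.exp_eq_exp_ℂ]

/-- Powers: `(e^{iθ})ⁿ = e^{inθ}` (as units). [folklore] -/
private theorem eI_pow (θ : ℝ) (n : ℕ) : (eI θ) ^ n = eI ((n : ℝ) * θ) := by
  apply Units.ext
  rw [Units.val_pow_eq_pow_val, val_eI, val_eI, ← exp_nsmul, nsmul_eq_mul]
  push_cast
  ring_nf

/-- The series logarithm (21) of [3] of `e^{iφ}` is `iφ` for `|φ| < ln 2` (`B7BlockAvgLog.mlog_exp`).
[cite: Balaban1985Averaging, (21) p.21] -/
theorem mlog_eI (φ : ℝ) (hφ : |φ| < Real.log 2) : mlog ((eI φ : ℂˣ) : ℂ) = I * (φ : ℂ) := by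
  rw [val_eI]
  apply B7BlockAvgLog.mlog_exp
  simpa [Complex.norm_real] using hφ

/-- `|e^{iφ} − 1| = 2|sin(φ/2)|`. [folklore] -/
private theorem norm_eI_sub_one (φ : ℝ) : ‖((eI φ : ℂˣ) : ℂ) - 1‖ = 2 * |Real.sin (φ / 2)| := by
  rw [val_eI_complex, Complex.norm_exp_I_mul_ofReal_sub_one, Real.norm_eq_abs, abs_mul, abs_two]

variable (L : ℕ)

/-- The number of bonds `Σ_κ r_κ` of the block contour `Γ_{y, y+r}`, `r ∈ [0, L)ᵈ`. [cite: Balaban1985Averaging, (2) p.17, p.24] -/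
def nbox (r : Fin d → Fin L) : ℕ := ∑ κ, (r κ : ℕ)

/-- `zc (Γ_{y,y+r}) = Σ_κ r_κ`. [cite: Balaban1985Averaging, p.24] -/
theorem zc_treeWord_boxVec (r : Fin d → Fin L) : zc (treeWord (boxVec L r)) = (nbox L r : ℤ) := by
  rw [zc_treeWord, nbox, Nat.cast_sum]
  rfl

/-- `Σ_κ r_κ ≤ d(L − 1)`. [folklore] -/
private theorem nbox_le (r : Fin d → Fin L) : nbox L r ≤ d * (L - 1) := by
  unfold nbox
  calc ∑ κ, (r κ : ℕ) ≤ ∑ _κ : Fin d, (L - 1) := Finset.sum_le_sum fun κ _ => Nat.le_sub_one_of_lt (r κ).isLt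
    _ = d * (L - 1) := by simp

/-- The mean staircase length: `Σ_r L^{−d}·Σ_κ r_κ = stairMean d L` (`= d(L−1)/2`, `B8Ineq145.stairMean_eq`).
[cite: Balaban1985Averaging, (2) p.17] -/
theorem sum_nbox_eq_stairMean : ∑ r : Fin d → Fin L, ((L : ℝ) ^ d)⁻¹ * (nbox L r : ℝ) = stairMean d L := by
  rw [stairMean, ← Finset.mul_sum, div_eq_inv_mul]
  congr 1
  push_cast [nbox]
  rfl

/-- **The exponent (110) of [3] for `U₁ ≡ e^{iθ}`**: `F(y) = Σ_{x∈B(y)} L^{−d} log e^{iθ·|Γ_{y,x}|} = iθ·d(L−1)/2` — every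
logarithm is the series logarithm of the tree, which requires `d(L−1)|θ| < ln 2`. [cite: Balaban1985Averaging, (110) p.34, (82) p.30] -/
theorem Favg_cst (θ : ℝ) (hθ : (d : ℝ) * ((L : ℝ) - 1) * |θ| < Real.log 2) (hL : 1 ≤ L) (q : Site d) :
    Favg L (cst (eI θ) : Site d → Fin d → ℂˣ) q = I * ((stairMean d L * θ : ℝ) : ℂ) := by
  have hterm : ∀ r : Fin d → Fin L,
      mlog ((hol (cst (eI θ) : Site d → Fin d → ℂˣ) q (treeWord (boxVec L r)) : ℂˣ) : ℂ)
        = I * (((nbox L r : ℝ) * θ : ℝ) : ℂ) := by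
    intro r
    rw [hol_cst, zc_treeWord_boxVec, zpow_natCast, eI_pow, mlog_eI]
    rw [abs_mul, Nat.abs_cast]
    have h1 : (nbox L r : ℝ) ≤ (d : ℝ) * ((L : ℝ) - 1) := by
      have h' : ((nbox L r : ℕ) : ℝ) ≤ ((d * (L - 1) : ℕ) : ℝ) := by exact_mod_cast nbox_le L r
      rw [Nat.cast_mul, Nat.cast_sub hL, Nat.cast_one] at h'
      exact h'
    calc (nbox L r : ℝ) * |θ| ≤ (d : ℝ) * ((L : ℝ) - 1) * |θ| := mul_le_mul_of_nonneg_right h1 (abs_nonneg θ)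
      _ < Real.log 2 := hθ
  unfold Favg
  simp_rw [hterm, Complex.real_smul]
  rw [← sum_nbox_eq_stairMean L]
  push_cast
  rw [Finset.sum_mul, Finset.mul_sum]
  exact Finset.sum_congr rfl fun r _ => by ring

/-- **The block frame (82) `\overline{R_{0,y}U₁}` of `U₁ ≡ e^{iθ}` at `U₀ = 1` is the constant `e^{iθ·d(L−1)/2}`.**
[cite: Balaban1985Averaging, (82) p.30, (110) p.34] -/
theorem vframe_cst (θ : ℝ) (hθ : (d : ℝ) * ((L : ℝ) - 1) * |θ| < Real.log 2) (hL : 1 ≤ L) (q : Site d) :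
    vframe L (cst (eI θ) : Site d → Fin d → ℂˣ) q = eI (stairMean d L * θ) := by
  apply Units.ext
  rw [vframe, val_expUnit, Favg_cst L θ hθ hL, val_eI]

/-- In the commutative group `ℂˣ` the frames of (89)/(90) at `V₀ = 1` cancel against nothing but each other: the exponent
(110) of a constant configuration does not depend on the block, so `V̿₁ = v⁻¹·V̄₁·v = V̄₁ ≡ c^L`.
[cite: Balaban1985Averaging, (89)–(90) p.31, (120) p.35] -/
theorem dbavg_cst (c : ℂˣ) : dbavg L (cst c : Site d → Fin d → ℂˣ) = cst (c ^ L) := by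
  funext q κ
  have hF : ∀ q' : Site d, vframe L (cst c : Site d → Fin d → ℂˣ) q' = vframe L (cst c : Site d → Fin d → ℂˣ) 0 := by
    intro q'
    simp only [vframe, Favg, hol_cst]
  rw [dbavg, bavg_cst, hF q, hF (q + (L : ℤ) • e κ)]
  exact inv_mul_cancel_comm _ _

/-- **(90)/(91) at `U₀ = 1` on `U₁ ≡ c`**: `U̿₁ʲ ≡ c^{L^j}`. [cite: Balaban1985Averaging, (90)–(91) p.31] -/
theorem dbavgIter_cst (c : ℂˣ) : ∀ j : ℕ, dbavgIter L (cst c : Site d → Fin d → ℂˣ) j = cst (c ^ L ^ j)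
  | 0 => by simp
  | j + 1 => by
    funext z κ
    rw [dbavgIter_succ, dbavgIter_cst c j, dbavg_cst, ← pow_mul, ← pow_succ]
    rfl

/-- `exp` of the constant exponent field: `expCfg (iθ) = (e^{iθ})`. [folklore] -/
private theorem expCfg_cst (θ : ℝ) : expCfg (cst (I * (θ : ℂ)) : Site d → Fin d → ℂ) = cst (eI θ) := by
  funext x κ; rfl

/-- **`exp iQ₁(U₀, ηA)` for `U₀ = 1`, `ηA ≡ θ`**: the composite (127) `Q₁ = Q(1, ηA) = (1/i) log U̿₁` of [3] at level 1 is
`(1/i) log e^{iLθ} = Lθ` (series logarithm, `L|θ| < ln 2`), so `exp iQ₁(U₀, ηA) = e^{iLθ}` on every bond.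
[cite: Balaban1985Averaging, (127) p.37, (121) p.36; Balaban1985RegularSpaces, (1.145) p.100] -/
theorem logIter_one_cst (θ : ℝ) (hθ : (L : ℝ) * |θ| < Real.log 2) (z : Site d) (κ : Fin d) :
    logIter L (cst (I * (θ : ℂ)) : Site d → Fin d → ℂ) 1 z κ = I * (((L : ℝ) * θ : ℝ) : ℂ) := by
  rw [logIter_succ, logIter_zero, expCfg_cst, dbavg_cst, cst_apply, eI_pow, mlog_eI]
  rwa [abs_mul, Nat.abs_cast]

/-- … in B8's letters: `exp (logCovIter L 1 (iηA) 1) = e^{iLθ}` (`B7Prop4GeneralLevels.logCovIter` = `Q_j(U₀, ηA)` up to the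
factor `i`, `logCovIter_one_left`). [cite: Balaban1985RegularSpaces, (1.145) p.100; Balaban1985Averaging, (127) p.37] -/
theorem exp_logCovIter_one_cst (θ : ℝ) (hθ : (L : ℝ) * |θ| < Real.log 2) (z : Site d) (κ : Fin d) :
    exp (logCovIter L (1 : Site d → Fin d → ℂˣ) (cst (I * (θ : ℂ))) 1 z κ) = ((eI ((L : ℝ) * θ) : ℂˣ) : ℂ) := by
  rw [logCovIter_one_left, logIter_one_cst L θ hθ, val_eI]

end Scalar

/-! ## §3 B8's geometry with one step (`k = 1`): `Λ₁ = {z : 0 ≤ z_{i₀}}`, `Λ₀ = {x : x_{i₀} < 0}`, and B8's gauge fixing -/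

section Geometry

variable {𝔸 : Type*} [NormedRing 𝔸] [NormedAlgebra ℂ 𝔸] [CompleteSpace 𝔸]

/-- The level sets `Λ_j` of (1.5) for the admissible sequence `Ω₀ = ℤᵈ ⊃ Ω₁ = {x : 0 ≤ x_{i₀}}` (`k = 1`; a half-space is a
union of `L`-blocks for every `L`, (1.4) with `R = ∞`): `Λ₁ = Ω₁^{(1)} = {z : 0 ≤ z_{i₀}}` (level-1 sites), `Λ₀ = Ω₀ ∖ B(Λ₁) =
{x : x_{i₀} < 0}` (level-0 sites), `Λ_j = ∅` for `j ≥ 2`. [cite: Balaban1985RegularSpaces, (1.3)–(1.6) p.77] -/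
def Lam (i₀ : Fin d) : ℕ → Set (Site d)
  | 0 => {x | x i₀ < 0}
  | 1 => {z | 0 ≤ z i₀}
  | _ + 2 => ∅

/-- `Λ₀ = {x : x_{i₀} < 0}`. [cite: Balaban1985RegularSpaces, (1.5) p.77] -/
@[simp] theorem mem_Lam_zero (i₀ : Fin d) (x : Site d) : x ∈ Lam i₀ 0 ↔ x i₀ < 0 := Iff.rfl

/-- `Λ₁ = {z : 0 ≤ z_{i₀}}`. [cite: Balaban1985RegularSpaces, (1.5) p.77] -/
@[simp] theorem mem_Lam_one (i₀ : Fin d) (z : Site d) : z ∈ Lam i₀ 1 ↔ 0 ≤ z i₀ := Iff.rfl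

/-- **B8's gauge fixing for this geometry** (p. 81: *"In [3] we have determined the gauge transformation u in terms of the
configuration U₁"*; (1.14)/(1.29)₀: `u = 1` on `Λ₀`): on the blocks under `Λ₁` (the sites `x` with `0 ≤ x_{i₀}`) it is the
gauge fixing `B7Eq84Concrete.glev … 1 0` of [3] ((76)–(77) below the values (87), `k = 1`), elsewhere `1`.
[cite: Balaban1985RegularSpaces, (1.29) p.81, (1.14) p.78; Balaban1985Averaging, (76)–(77) pp.29–30, (87) p.31] -/
def u8 (L : ℕ) (hL : 1 ≤ L) (i₀ : Fin d) (U₀ U₁ : Site d → Fin d → 𝔸ˣ) : Site d → 𝔸ˣ :=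
  fun x => if 0 ≤ x i₀ then glev L hL U₀ U₁ 1 0 x else 1

variable (L : ℕ) (hL : 1 ≤ L) (i₀ : Fin d) (U₀ U₁ : Site d → Fin d → 𝔸ˣ)

/-- On a block under `Λ₁` the gauge fixing is `glev`. [folklore] -/
private theorem u8_of_nonneg {x : Site d} (hx : 0 ≤ x i₀) : u8 L hL i₀ U₀ U₁ x = glev L hL U₀ U₁ 1 0 x := by
  simp [u8, hx]

/-- On `Λ₀` the gauge fixing is `1` ((1.14)). [cite: Balaban1985RegularSpaces, (1.14) p.78] -/
theorem u8_of_neg {x : Site d} (hx : x i₀ < 0) : u8 L hL i₀ U₀ U₁ x = 1 := by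
  simp [u8, not_le.mpr hx]

include hL in
/-- The block points `Lz + r`, `r ∈ [0, L)ᵈ`, under a `Λ₁`-site `z` have non-negative `i₀`-coordinate. [folklore] -/
private theorem block_nonneg {z : Site d} (hz : 0 ≤ z i₀) (r : Fin d → Fin L) : 0 ≤ ((L : ℤ) • z + boxVec L r) i₀ := by
  have h1 : (0 : ℤ) ≤ (L : ℤ) * z i₀ := mul_nonneg (by positivity) hz
  simp only [Pi.add_apply, Pi.smul_apply, smul_eq_mul, boxVec]
  positivity

/-- The corner `Lz` of the block under a `Λ₁`-site `z`. [folklore] -/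
private theorem corner_nonneg {z : Site d} (hz : 0 ≤ z i₀) : 0 ≤ ((L : ℤ) • z) i₀ := by
  simp only [Pi.smul_apply, smul_eq_mul]
  exact mul_nonneg (by positivity) hz

/-- **(1.29) holds for `u₈`**: `(\overline{R₀u₈}ʲ)(y) = 1` for `y ∈ Λ_j`, `j = 0, 1` — at `j = 0` because `u₈ = 1` on `Λ₀`, at
`j = 1` because the twisted site average (78)/(79) over the block `B(Lz)` sees only the values of `u₈` on that block
(`B7Eq84Concrete.savg_congr`), where `u₈ = glev`, and `glev` satisfies (81) (`B7Eq84Concrete.eq81_glev`).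
[cite: Balaban1985RegularSpaces, (1.29) p.81; Balaban1985Averaging, (78)–(81) p.30] -/
theorem restr129_u8 : Restr129 L 1 (Lam i₀) U₀ (u8 L hL i₀ U₀ U₁) := by
  rw [restr129_iff_uavg]
  intro j hj y hy
  interval_cases j
  · -- level 0: `u₈(y) = 1` on `Λ₀`
    rw [uavg_zero]
    exact u8_of_neg L hL i₀ U₀ U₁ ((mem_Lam_zero i₀ y).1 hy)
  · -- level 1: the site average over `B(Ly)` sees `glev` only
    have hy' : 0 ≤ y i₀ := (mem_Lam_one i₀ y).1 hy
    rw [uavg_one, R0avg]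
    have key : savg L (R0fun U₀ ((L : ℤ) • y) (u8 L hL i₀ U₀ U₁)) ((L : ℤ) • y)
        = savg L (R0fun U₀ ((L : ℤ) • y) (glev L hL U₀ U₁ 1 0)) ((L : ℤ) • y) := by
      apply savg_congr
      · rw [R0fun_self, R0fun_self, u8_of_nonneg L hL i₀ U₀ U₁ (corner_nonneg L i₀ hy')]
      · intro r
        rw [R0fun_add, R0fun_add, u8_of_nonneg L hL i₀ U₀ U₁ (block_nonneg L hL i₀ hy' r)]
    rw [key]
    have h81 := eq81_glev L hL U₀ U₁ 1 y
    rwa [uavg_one, R0avg] at h81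

/-- **`U′U₀ = (U₁U₀)^{u₈} ∈ Ax_1(𝔅_1, U₀)`** (the axial-gauge clause of (1.144)): the conditions (1.19) in the blocks under the
`Λ₁`-sites hold because there `u₈ = glev` at both ends of every block contour and `glev` puts `U₁` into the block axial
gauge (67) of [3] (`B7Eq84Concrete.axialGauge_glev`); (1.19) at a block IS (67) there (`B8Eq131Derivation.ax119_iff_ax67`).
[cite: Balaban1985RegularSpaces, (1.19) p.79, (1.144) p.100; Balaban1985Averaging, (67) p.29, (76)–(77) pp.29–30] -/
theorem inAx_u8 : InAx L 1 (Lam i₀) U₀ (mgauge U₀ (u8 L hL i₀ U₀ U₁) U₁ * U₀) := by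
  intro j hj1 hjk xj hxj n hn z hz r
  obtain rfl : j = 1 := le_antisymm hjk hj1
  obtain rfl : n = 0 := Nat.lt_one_iff.mp hn
  have hz' : z = xj := (under_zero_iff L xj z).1 (by simpa using hz)
  subst hz'
  have hz0 : 0 ≤ z i₀ := (mem_Lam_one i₀ z).1 hxj
  rw [ax119_iff_ax67, avgIter_zero, tildIter_zero', tHol_mgauge, disp_treeWord,
    u8_of_nonneg L hL i₀ U₀ U₁ (corner_nonneg L i₀ hz0), u8_of_nonneg L hL i₀ U₀ U₁ (block_nonneg L hL i₀ hz0 r)]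
  have h67 := axialGauge_glev L hL U₀ U₁ 1 0 Nat.zero_lt_one z r
  rwa [avgIter_zero, tildIter_zero', tHol_mgauge, disp_treeWord] at h67

end Geometry

/-! ## §4 The crossing bonds `b = ⟨y, y + e_{i₀}⟩`, `y_{i₀} = −1` (`b₊ ∈ Λ₁`, `B(b₋) ⊂ Λ₀`) -/

section Crossing

variable {𝔸 : Type*} [NormedRing 𝔸] [NormedAlgebra ℂ 𝔸] [CompleteSpace 𝔸]
variable (L : ℕ) (hL : 1 ≤ L) (i₀ : Fin d) (U₀ U₁ : Site d → Fin d → 𝔸ˣ)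

/-- **p. 81 for `u₈`, EVERY background `U₀`, EVERY `U₁`**: on a bond `b = ⟨y, y + e_{i₀}⟩` of the level-1 lattice with
`y_{i₀} = −1` — it crosses the boundary of `Λ₁` (`b₊ = y + e_{i₀} ∈ Λ₁`, while the block `B(b₋)` lies in `Λ₀`) —
*"the formulas (97), (99), and (87) of [3] imply (Ũ₁^{u j})_b = \overline{R̄^{j−1}_{0,b₋}Ū₁^{j−1}}(Ū₁ʲ)_b"*: here, with
`j = 1`, `Ũ′¹_b = \overline{R_{0,b₋}U₁}·(U̿₁¹)_b`, the factor being the block frame (82) of [3] (`B7Eq92Concrete.wframe`) and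
`U̿₁¹` the double-bar average (90) (`B7Eq92Concrete.dbavgCovIter`) — r05 g5's `B8Eq131Derivation.eq130_crossing` with its two
(87)-hypotheses DISCHARGED by the definition of `u₈` (`u₈(b₋) = 1 = w₀(b₋)⁻¹`; `u₈(Lb₊) = glev(Lb₊) = w₁(b₊)⁻¹` by
`glev_centre`/`glev_top`).  No smallness, no commutativity. [cite: Balaban1985RegularSpaces, (1.30)–(1.31) pp.81–82; Balaban1985Averaging, (97) p.32, (99) p.32, (87) p.31, (82) p.30] -/
theorem tildIter_u8_crossing (y : Site d) (hy : y i₀ = -1) :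
    tildIter L U₀ (mgauge U₀ (u8 L hL i₀ U₀ U₁) U₁) 1 y i₀
      = wframe L U₀ U₁ ((L : ℤ) • y) * dbavgCovIter L U₀ U₁ 1 y i₀ := by
  have hm : uLev L (u8 L hL i₀ U₀ U₁) 0 ((L : ℤ) • y) = (wrec L U₀ U₁ 0 ((L : ℤ) • y))⁻¹ := by
    rw [uLev_zero, wrec_zero, inv_one]
    apply u8_of_neg
    simp only [Pi.smul_apply, smul_eq_mul, hy, mul_neg, mul_one, Left.neg_neg_iff]
    exact_mod_cast hL
  have hp : uLev L (u8 L hL i₀ U₀ U₁) (0 + 1) (y + e i₀) = (wrec L U₀ U₁ (0 + 1) (y + e i₀))⁻¹ := by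
    rw [← uLev_smul, uLev_zero, zero_add]
    have h0 : 0 ≤ ((L : ℤ) • (y + e i₀)) i₀ := by
      simp [Pi.smul_apply, e_apply, hy]
    rw [u8_of_nonneg L hL i₀ U₀ U₁ h0, glev_centre L hL U₀ U₁ Nat.zero_lt_one, glev_top]
  have h := eq130_crossing L U₀ U₁ (u8 L hL i₀ U₀ U₁) 0 y i₀ hm hp
  rwa [avgIter_zero, dbavgCovIter_zero] at h

/-- The same in print's letters: `(U′U₀)‾¹_b = \overline{R_{0,b₋}U₁}·(U̿₁¹)_b·(Ū₀¹)_b` ((69): `Ũ′ʲ = (\overline{U′U₀})ʲ(Ū₀ʲ)⁻¹`).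
[cite: Balaban1985RegularSpaces, (1.20) p.79, (1.30) p.81; Balaban1985Averaging, (69) p.29] -/
theorem avgIter_u8_crossing (y : Site d) (hy : y i₀ = -1) :
    avgIter L (mgauge U₀ (u8 L hL i₀ U₀ U₁) U₁ * U₀) 1 y i₀
      = wframe L U₀ U₁ ((L : ℤ) • y) * dbavgCovIter L U₀ U₁ 1 y i₀ * avgIter L U₀ 1 y i₀ := by
  rw [← tildIter_u8_crossing L hL i₀ U₀ U₁ y hy, tildIter_apply, inv_mul_cancel_right]

end Crossing

/-! ## §5 The witness: `𝔸 = ℂ`, `U₀ = 1`, `U₁ ≡ e^{iθ}` — both members of (1.145) in closed form, and the hypotheses of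
Prop. 7 -/

section Witness

open Complex (I)

variable (L : ℕ) (hL : 1 ≤ L) (i₀ : Fin d)

/-- `e^{ia}e^{ib} = e^{i(a+b)}`. [folklore] -/
private theorem eI_add (a b : ℝ) : eI (a + b) = eI a * eI b := by
  apply Units.ext
  rw [Units.val_mul, val_eI_complex, val_eI_complex, val_eI_complex, ← Complex.exp_add]
  push_cast
  ring_nf

/-- **`Ũ′¹_b` ON THE CROSSING BOND, EVALUATED**: `Ũ′¹_b = \overline{R_{0,b₋}U₁}·(U̿₁¹)_b = e^{iθ·d(L−1)/2}·e^{iLθ}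
= e^{i·flatRatio(d,L)·Lθ}` (`flatRatio d L = 1 + d(L−1)/(2L)`, `B8Ineq145.flat_log_identity`).
[cite: Balaban1985RegularSpaces, (1.30)–(1.31) pp.81–82, (1.145) p.100; Balaban1985Averaging, (82) p.30, (90) p.31] -/
theorem tildIter_crossing_cst (θ : ℝ) (hθ : (d : ℝ) * ((L : ℝ) - 1) * |θ| < Real.log 2) (y : Site d) (hy : y i₀ = -1) :
    tildIter L (1 : Site d → Fin d → ℂˣ) (mgauge 1 (u8 L hL i₀ 1 (cst (eI θ))) (cst (eI θ))) 1 y i₀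
      = eI (flatRatio d L * ((L : ℝ) * θ)) := by
  rw [tildIter_u8_crossing L hL i₀ 1 (cst (eI θ)) y hy, wframe_one_left, dbavgCovIter_one_left,
    vframe_cst L θ hθ hL, dbavgIter_cst, cst_apply, pow_one, eI_pow, ← eI_add,
    B8Ineq145.flat_log_identity d L hL]

/-- **THE LEFT MEMBER OF (1.145) on the crossing bond**: `|(U′U₀)‾¹_b − Ū₀¹_b| = |Ũ′¹_b − 1| = 2|sin(flatRatio(d,L)·Lθ/2)|`
(`U₀ = 1`, so `Ū₀¹ = 1` and `(U′U₀)‾¹ = Ũ′¹`, [3] (43)/(69)). [cite: Balaban1985RegularSpaces, (1.145) p.100; Balaban1985Averaging, (43) p.24, (69) p.29] -/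
theorem norm_lhs145_crossing (θ : ℝ) (hθ : (d : ℝ) * ((L : ℝ) - 1) * |θ| < Real.log 2) (y : Site d) (hy : y i₀ = -1) :
    ‖((avgIter L (mgauge 1 (u8 L hL i₀ 1 (cst (eI θ))) (cst (eI θ)) * (1 : Site d → Fin d → ℂˣ)) 1 y i₀ : ℂˣ) : ℂ)
        - ((avgIter L (1 : Site d → Fin d → ℂˣ) 1 y i₀ : ℂˣ) : ℂ)‖
      = 2 * |Real.sin (flatRatio d L * ((L : ℝ) * θ) / 2)| := by
  rw [avgIter_u8_crossing L hL i₀ 1 (cst (eI θ)) y hy, ← tildIter_u8_crossing L hL i₀ 1 (cst (eI θ)) y hy,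
    tildIter_crossing_cst L hL i₀ θ hθ y hy, avgIter_one, Pi.one_apply, Pi.one_apply, mul_one, Units.val_one,
    norm_eI_sub_one]

/-- **THE RIGHT MEMBER OF (1.145)**: `|exp iQ₁(U₀, ηA) − 1| = |e^{iLθ} − 1| = 2|sin(Lθ/2)|` on every level-1 bond.
[cite: Balaban1985RegularSpaces, (1.145) p.100; Balaban1985Averaging, (127) p.37] -/
theorem norm_rhs145 (θ : ℝ) (hθ : (L : ℝ) * |θ| < Real.log 2) (z : Site d) (κ : Fin d) :
    ‖exp (logCovIter L (1 : Site d → Fin d → ℂˣ) (cst (I * (θ : ℂ))) 1 z κ) - 1‖ = 2 * |Real.sin ((L : ℝ) * θ / 2)| := by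
  rw [exp_logCovIter_one_cst L θ hθ z κ, norm_eI_sub_one]

/-! ### The hypotheses (1.139), (1.140), (1.143) and the `𝔄_k` clause of (1.144) for the witness -/

/-- **(1.139) for `U₀ = 1`**: `1 ∈ 𝔄_k({Ω_j}, α₀)` for every family of domains, every `η > 0`, `α₀ > 0` (all plaquette
variables are `1`, all covariant divergences `0`; `B8Prop6OfThm4.one_inAk`). [cite: Balaban1985RegularSpaces, (1.139) p.100, (1.7)/(1.9) p.77] -/
theorem hyp139 (hL : 1 ≤ L) (k : ℕ) {η α₀ : ℝ} (hη : 0 < η) (hα₀ : 0 < α₀) (Ω : ℕ → Set (Site d)) :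
    InAk L k η α₀ Ω (1 : Site d → Fin d → ℂˣ) :=
  one_inAk hL k hη hα₀ Ω

/-- **(1.140), first member, for `ηA ≡ θ`**: `L^jη|A| = L^j|θ|`; the witness takes `L^j|θ| < α₂` for `j = 0, 1` — here the
exponent field `iηA = iθ` as the lineage types it (`U₁ = expCfg (iηA)`), `|iθ| = |θ|`. [cite: Balaban1985RegularSpaces, (1.140) p.100] -/
theorem hyp140_abs (θ : ℝ) (x : Site d) (κ : Fin d) : ‖(cst (I * (θ : ℂ)) : Site d → Fin d → ℂ) x κ‖ = |θ| := by
  simp [Complex.norm_real]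

/-- **(1.140), derivative members, for a CONSTANT 𝔤-valued field at the flat background**: the covariant gradient (1.1)
`∇^η_{U₀}` of a constant function vanishes at `U₀ = 1` (`R(1) = id`), hence so do `(L^jη)²|∇^η_{U₀}A|` and
`(L^jη)³|D^{η*}_{U₀}D^η_{U₀}A|`. [cite: Balaban1985RegularSpaces, (1.140) p.100, (1.1) p.76] -/
theorem hyp140_grad (η : ℝ) (a : ℂ) (μ : Fin d) (x : Site d) :
    covDerivFwd η (1 : Site d → Fin d → ℂˣ) μ (fun _ => a) x = 0 := by
  simp [covDerivFwd, conjR_apply]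

/-- … and the second covariant derivative of the constant (the zero function differentiated once more).
[cite: Balaban1985RegularSpaces, (1.140) p.100, (1.1) p.76] -/
theorem hyp140_lap (η : ℝ) (a : ℂ) (μ ν : Fin d) (x : Site d) :
    covDeriv η (1 : Site d → Fin d → ℂˣ) ν (covDerivFwd η (1 : Site d → Fin d → ℂˣ) μ (fun _ => a)) x = 0 := by
  have h : covDerivFwd η (1 : Site d → Fin d → ℂˣ) μ (fun _ : Site d => a) = fun _ => 0 :=
    funext fun z => hyp140_grad η a μ z
  rw [h]
  simp [covDeriv, conjR_apply]

/-- **(1.143) for the witness**: `|Q₁(U₀, ηA)| = |(1/i)·iLθ| = L|θ|` (and `|Q₀| = |θ|`); the witness has `L|θ| < α₂ < 2α₂`.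
[cite: Balaban1985RegularSpaces, (1.143) p.100; Balaban1985Averaging, (127) p.37] -/
theorem hyp143 (θ : ℝ) (hθ : (L : ℝ) * |θ| < Real.log 2) (z : Site d) (κ : Fin d) :
    ‖logCovIter L (1 : Site d → Fin d → ℂˣ) (cst (I * (θ : ℂ))) 1 z κ‖ = (L : ℝ) * |θ| := by
  rw [logCovIter_one_left, logIter_one_cst L θ hθ z κ]
  simp [Complex.norm_real]

/-- **The `𝔄_k` clause of (1.144) for the witness, with room to spare**: every plaquette variable of `U′U₀ = (U₁U₀)^{u₈}`
is `1` and every covariant divergence (1.2) is `0` (gauge covariance (1.11)/p. 77 `B8Ineq132.plaqF_gaugeAct`/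
`covDiv_gaugeAct`, and the constant abelian `U₁`), so `U′U₀ ∈ 𝔄_k({Ω_j}, α)` for EVERY `α > 0` — in particular for
`α₀ + 3α₂`. [cite: Balaban1985RegularSpaces, (1.144) p.100, (1.7)/(1.9)/(1.11) p.77] -/
theorem hyp144_inAk (hL : 1 ≤ L) (c : ℂˣ) (u : Site d → ℂˣ) (k : ℕ) {η α : ℝ} (hη : 0 < η) (hα : 0 < α) (Ω : ℕ → Set (Site d)) :
    InAk L k η α Ω (mgauge (1 : Site d → Fin d → ℂˣ) u (cst c) * 1) := by
  have hL0 : 0 < L := hL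
  have hplaq : ∀ (μ ν : Fin d) (x : Site d), plaqF (cst c : Site d → Fin d → ℂˣ) μ ν x = 1 := by
    intro μ ν x
    rw [plaqF, hol_cst]
    simp [plaqWord]
  have hdiv : ∀ (μ : Fin d) (x : Site d), covDiv η (cst c : Site d → Fin d → ℂˣ) μ x = 0 := by
    intro μ x
    have h1 : ∀ κ κ' : Fin d, plaqF (cst c : Site d → Fin d → ℂˣ) κ κ' = fun _ => (1 : ℂ) :=
      fun κ κ' => funext fun z => hplaq κ κ' z
    simp [covDiv, h1, covDeriv, conjR_apply]
  rw [mul_one, mgauge_one_left]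
  intro j _
  refine ⟨fun x μ ν _ _ => ?_, fun x μ _ => ?_⟩
  · rw [plaqF_gaugeAct, hplaq, conjR_one, sub_self, norm_zero]; positivity
  · rw [covDiv_gaugeAct, hdiv]; simp only [conjR_apply, mul_zero, zero_mul, norm_zero]; positivity

/-! ### Main theorems: the display (1.145) fails on the crossing bond (`d = 4`, `L = 3`) -/

/-- Numerical bookkeeping of the witness: with `3θ = (27/28)α₂`, `0 < α₂ ≤ 1/4`, every series logarithm used above is
inside its disc (`8|θ| < ln 2`, `3|θ| < ln 2`) and `θ > 0`. [folklore] -/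
private theorem witness_small {α₂ θ : ℝ} (h0 : 0 < α₂) (h1 : α₂ ≤ 1 / 4) (hθ : (3 : ℝ) * θ = 27 / 28 * α₂) :
    0 < θ ∧ ((4 : ℕ) : ℝ) * (((3 : ℕ) : ℝ) - 1) * |θ| < Real.log 2 ∧ ((3 : ℕ) : ℝ) * |θ| < Real.log 2 := by
  have hθpos : 0 < θ := by linarith
  have hlog := Real.log_two_gt_d9
  refine ⟨hθpos, ?_, ?_⟩ <;> rw [abs_of_pos hθpos] <;> push_cast <;> nlinarith

/-- **THE INEQUALITY OF (1.145) FAILS ON THE LINEAGE CARRIERS.**  `d = 4`, `L = 3`, `k = 1`, the half-space geometry of §3,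
`U₀ = 1`, `U₁ ≡ e^{iθ}` with `Lθ = (27/28)α₂` (so (1.140): `L^j|ηA| = L^j|θ| < α₂` for `j = 0, 1`, all derivative
members `0`; (1.139) and (1.143) hold, §5), `U′U₀ = (U₁U₀)^{u₈}` in the gauge of (1.144) (`inAx_u8`, `restr129_u8`,
`hyp144_inAk`): on every bond `b = ⟨y, y + e_{i₀}⟩` of the level-1 lattice crossing into `Λ₁` (`y_{i₀} = −1`),
`2α₂ < |(U′U₀)‾¹_b − Ū₀¹_b|` for ALL `0 < α₂ ≤ 1/4` — the printed «< 2α₂» fails, however small `α₀, α₂` are taken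
(`B8Ineq145.flat_witness_exceeds`: the value is `2 sin((9/8)α₂)`). [cite: Balaban1985RegularSpaces, Prop. 7 (1.145) p.100] -/
theorem ineq145_fails_lineage (i₀ : Fin 4) {α₂ θ : ℝ} (h0 : 0 < α₂) (h1 : α₂ ≤ 1 / 4)
    (hθ : (3 : ℝ) * θ = 27 / 28 * α₂) (y : Site 4) (hy : y i₀ = -1) :
    2 * α₂ < ‖((avgIter 3 (mgauge 1 (u8 3 (by norm_num) i₀ 1 (cst (eI θ))) (cst (eI θ))
          * (1 : Site 4 → Fin 4 → ℂˣ)) 1 y i₀ : ℂˣ) : ℂ) - ((avgIter 3 (1 : Site 4 → Fin 4 → ℂˣ) 1 y i₀ : ℂˣ) : ℂ)‖ := by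
  obtain ⟨-, h8, -⟩ := witness_small h0 h1 hθ
  rw [norm_lhs145_crossing 3 (by norm_num) i₀ θ h8 y hy]
  have hcast : ((3 : ℕ) : ℝ) * θ = 27 / 28 * α₂ := by push_cast; exact hθ
  rw [hcast]
  calc 2 * α₂ < 2 * Real.sin (flatRatio 4 3 * (27 / 28 * α₂) / 2) := flat_witness_exceeds α₂ h0 (by linarith)
    _ ≤ 2 * |Real.sin (flatRatio 4 3 * (27 / 28 * α₂) / 2)| := by gcongr; exact le_abs_self _

/-- **THE EQUALITY OF (1.145) FAILS ON THE LINEAGE CARRIERS** (same data): on the crossing bond the left member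
`|(U′U₀)‾¹_b − Ū₀¹_b| = 2 sin((9/8)α₂)` exceeds `2α₂`, while the right member `|exp iQ₁(U₀, ηA)_b − 1| = 2|sin((27/56)α₂)|`
is `< 2·(27/56)α₂ < 2α₂` — the two members of the displayed equality differ (the block factor `\overline{R_{0,b₋}U₁} =
e^{iθ·d(L−1)/2} ≠ 1`, G-B8-01 (b)). [cite: Balaban1985RegularSpaces, Prop. 7 (1.145) p.100, (1.31) p.82] -/
theorem eq145_fails_lineage (i₀ : Fin 4) {α₂ θ : ℝ} (h0 : 0 < α₂) (h1 : α₂ ≤ 1 / 4)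
    (hθ : (3 : ℝ) * θ = 27 / 28 * α₂) (y : Site 4) (hy : y i₀ = -1) :
    ‖((avgIter 3 (mgauge 1 (u8 3 (by norm_num) i₀ 1 (cst (eI θ))) (cst (eI θ))
          * (1 : Site 4 → Fin 4 → ℂˣ)) 1 y i₀ : ℂˣ) : ℂ) - ((avgIter 3 (1 : Site 4 → Fin 4 → ℂˣ) 1 y i₀ : ℂˣ) : ℂ)‖
      ≠ ‖exp (logCovIter 3 (1 : Site 4 → Fin 4 → ℂˣ) (cst (I * (θ : ℂ))) 1 y i₀) - 1‖ := by
  obtain ⟨hθpos, -, h3⟩ := witness_small h0 h1 hθ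
  have hlhs := ineq145_fails_lineage i₀ h0 h1 hθ y hy
  have hrhs : ‖exp (logCovIter 3 (1 : Site 4 → Fin 4 → ℂˣ) (cst (I * (θ : ℂ))) 1 y i₀) - 1‖ < 2 * α₂ := by
    rw [norm_rhs145 3 θ h3 y i₀]
    have hx : 0 < ((3 : ℕ) : ℝ) * θ / 2 := by positivity
    have hxπ : ((3 : ℕ) : ℝ) * θ / 2 < Real.pi := by
      have := Real.pi_gt_three
      push_cast; nlinarith
    rw [abs_of_pos (Real.sin_pos_of_pos_of_lt_pi hx hxπ)]
    have hs := Real.sin_lt hx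
    push_cast at hs ⊢
    nlinarith
  exact fun h => by linarith [h ▸ hlhs]

/-- **G-B8-01 ON THE LINEAGE CARRIERS — one existential statement.**  There are `d, L`, an admissible geometry
`{Λ_j}` (`k = 1`), `η > 0` and, for EVERY `0 < α₂ ≤ 1/4` and EVERY `α₀ > 0`, a background `U₀ ∈ 𝔄_k({Ω_j}, α₀)` ((1.139)),
a field `U₁ = e^{iηA}` with `L^jη|A| < α₂`, `∇^η_{U₀}A = 0`, `D^{η*}_{U₀}D^η_{U₀}A = 0` ((1.140)) and `|Q_j(U₀, ηA)| < 2α₂`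
((1.143)), and a gauge transformation `u` satisfying (1.29) with `U′U₀ = (U₁U₀)^u ∈ 𝔄_k({Ω_j}, α₀ + 3α₂) ∩ Ax_k(𝔅_k, U₀)`
((1.144)), such that on a bond `b` of `Λ₁` (a bond of `Ω₁^{(1)}` in the convention of p. 77) BOTH the equality and the
inequality of the display (1.145) fail: `|(U′U₀)‾¹_b − Ū₀¹_b| ≠ |exp iQ₁(U₀, ηA)_b − 1|` and `|(U′U₀)‾¹_b − Ū₀¹_b| > 2α₂`.
(All objects are the lineage's: `avgIter`, `mgauge`, `logCovIter`, `InAk`, `InAx`, `Restr129`.)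
[cite: Balaban1985RegularSpaces, Prop. 7 (1.144)–(1.145) p.100, (1.139)–(1.140) p.100, (1.143) p.100, (1.29) p.81] -/
theorem prop7_display145_refuted {α₀ α₂ : ℝ} (hα₀ : 0 < α₀) (h0 : 0 < α₂) (h1 : α₂ ≤ 1 / 4) :
    ∃ (θ : ℝ) (u : Site 4 → ℂˣ) (y : Site 4) (i₀ : Fin 4),
      -- (1.139) for `U₀ = 1` (any domains, `η = 1`)
      (∀ Ω : ℕ → Set (Site 4), InAk 3 1 (1 : ℝ) α₀ Ω (1 : Site 4 → Fin 4 → ℂˣ)) ∧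
      -- (1.140): `L^j|ηA| < α₂`, `j = 0, 1`; the derivative members vanish
      (|θ| < α₂ ∧ (3 : ℝ) * |θ| < α₂ ∧
        (∀ (μ : Fin 4) (x : Site 4), covDerivFwd (1 : ℝ) (1 : Site 4 → Fin 4 → ℂˣ) μ (fun _ => (θ : ℂ)) x = 0)) ∧
      -- (1.143): `|Q₁(U₀, ηA)| < 2α₂`
      (∀ (z : Site 4) (κ : Fin 4), ‖logCovIter 3 (1 : Site 4 → Fin 4 → ℂˣ) (cst (I * (θ : ℂ))) 1 z κ‖ < 2 * α₂) ∧
      -- (1.144): the gauge conditions (1.29)/(1.19) for `u`, and `U′U₀ ∈ 𝔄_k(α₀ + 3α₂)` (any domains)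
      Restr129 3 1 (Lam i₀) (1 : Site 4 → Fin 4 → ℂˣ) u ∧
      InAx 3 1 (Lam i₀) (1 : Site 4 → Fin 4 → ℂˣ) (mgauge 1 u (cst (eI θ)) * 1) ∧
      (∀ Ω : ℕ → Set (Site 4), InAk 3 1 (1 : ℝ) (α₀ + 3 * α₂) Ω (mgauge 1 u (cst (eI θ)) * 1)) ∧
      -- the bond `b = ⟨y, y + e_{i₀}⟩` lies on `Λ₁` (`b₊ ∈ Λ₁`) …
      y + e i₀ ∈ Lam i₀ 1 ∧
      -- … and there (1.145) fails, equality and inequality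
      ‖((avgIter 3 (mgauge 1 u (cst (eI θ)) * (1 : Site 4 → Fin 4 → ℂˣ)) 1 y i₀ : ℂˣ) : ℂ)
          - ((avgIter 3 (1 : Site 4 → Fin 4 → ℂˣ) 1 y i₀ : ℂˣ) : ℂ)‖
        ≠ ‖exp (logCovIter 3 (1 : Site 4 → Fin 4 → ℂˣ) (cst (I * (θ : ℂ))) 1 y i₀) - 1‖ ∧
      2 * α₂ < ‖((avgIter 3 (mgauge 1 u (cst (eI θ)) * (1 : Site 4 → Fin 4 → ℂˣ)) 1 y i₀ : ℂˣ) : ℂ)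
          - ((avgIter 3 (1 : Site 4 → Fin 4 → ℂˣ) 1 y i₀ : ℂˣ) : ℂ)‖ := by
  set θ : ℝ := 9 / 28 * α₂ with hθdef
  have hθ : (3 : ℝ) * θ = 27 / 28 * α₂ := by rw [hθdef]; ring
  obtain ⟨hθpos, -, h3⟩ := witness_small h0 h1 hθ
  have hL : 1 ≤ 3 := by norm_num
  let i₀ : Fin 4 := 0
  let y : Site 4 := fun i => if i = i₀ then -1 else 0
  have hy : y i₀ = -1 := by simp [y]
  refine ⟨θ, u8 3 hL i₀ 1 (cst (eI θ)), y, i₀, fun Ω => hyp139 3 hL 1 one_pos hα₀ Ω, ⟨?_, ?_, ?_⟩, ?_,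
    restr129_u8 3 hL i₀ 1 _, inAx_u8 3 hL i₀ 1 _, fun Ω => hyp144_inAk 3 hL _ _ 1 one_pos (by linarith) Ω, ?_,
    eq145_fails_lineage i₀ h0 h1 hθ y hy, ineq145_fails_lineage i₀ h0 h1 hθ y hy⟩
  · rw [abs_of_pos hθpos]; linarith
  · rw [abs_of_pos hθpos]; linarith
  · exact fun μ x => hyp140_grad 1 _ μ x
  · intro z κ
    rw [hyp143 3 θ h3 z κ, abs_of_pos hθpos]
    push_cast; linarith
  · show 0 ≤ (y + e i₀) i₀
    simp [y, e_apply]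

end Witness

/-! ## §6 The typed sentence `B8.Prop7Printed` REFUTED for the lineage family (model instance)

`B8.Prop7Printed fam toAxial` (r1 typing, `B8.lean`) quantifies over abstract carriers `B8.GFData`; it READS only the
fields `InA` ((1.139)), `C162 1 α₂` ((1.140), "the (1.140) bound with constant 1"), `InAAx` ((1.144)) and `avgClose`
((1.145) ↦ (1.35)) and the map `toAxial` (`U₁ ↦ U′`, the axial representative of (1.144)).  `lineageGF7` below is the
`GFData` packaging of the lineage model of §§3–5 (`d = 4`, `L = 3`, `k = 1`, `η = 1`, `i₀ = 0`) FOR PROPOSITION 7: those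
four fields are the lineage's concrete predicates — (1.139) ↦ `InAk` over the domains `Ω₀ = ℤ⁴ ⊃ Ω₁ = B(Λ₁)`
(`OmegaFine`), (1.140) ↦ ALL THREE members for `A = (1/i) log U₁` (series logarithm) at every site, so that `C162 1 α₂`
implies (1.140) (as a hypothesis this keeps the packaged Prop. 7 a consequence of the printed one), (1.144) ↦ `InAk ∧ InAx`
over the same domains, (1.145)/(1.35) ↦ the bound on the level-`j` bonds of `Λ_j` (bond convention of p. 77; implied by the
printed "on Ω_j^{(j)}") —, and
`toAxial U₀ U₁ = U₁^{u₈}` ((55)/(1.17)) with B8's gauge fixing `u₈` of §3 (which satisfies (1.29) and puts `U′U₀` into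
`Ax_1(𝔅_1, U₀)` for EVERY `U₀, U₁`: `restr129_u8`, `inAx_u8`).  The fields of `GFData` that `Prop7Printed` does NOT read
(the clauses (1.36)–(1.39), (1.62), (1.146), (3.35) of Theorems 2/4/8 and Props. 3/5/6) are not modelled on these carriers
and are set to `True`/trivial data — they are bound but unused by `Prop7Printed`. -/

section Typed

open Complex (I)

/-- `1 ≤ 3`. [folklore] -/
private theorem one_le_three' : 1 ≤ 3 := by norm_num

/-- The vector potential `A = (1/(iη)) log U₁` of `U₁ = e^{iηA}` (`η = 1`; `log` = the series logarithm (21) of [3]).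
[cite: Balaban1985RegularSpaces, (1.140) p.100 ("U₁ = e^{iηA}")] -/
def Apot (U₁ : Site 4 → Fin 4 → ℂˣ) : Site 4 → Fin 4 → ℂ := fun x κ => I⁻¹ * mlog ((U₁ x κ : ℂˣ) : ℂ)

/-- A level-`j` bond `⟨z, z + e_κ⟩` lies "on `Λ_j`" iff one of its end-points does (p. 77: *"{bonds b ⊂ T: at least one
end-point of b belongs to Ω}"*). [cite: Balaban1985RegularSpaces, p.77 (bond convention)] -/
def Touch (j : ℕ) (z : Site 4) (κ : Fin 4) : Prop := z ∈ Lam (0 : Fin 4) j ∨ z + e κ ∈ Lam (0 : Fin 4) j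

/-- The domains `Ω_j` of the geometry of §3 as sets of sites of the FINE lattice (the convention of `B8Ineq132.InAk`:
plaquettes/bonds touching `Ω_j` get the level-`j` thresholds of (1.7)/(1.9)): `Ω₀ = ℤ⁴`, `Ω₁ = B(Λ₁) = {x : 0 ≤ x₀}`.
[cite: Balaban1985RegularSpaces, (1.3)–(1.6) p.77] -/
def OmegaFine : ℕ → Set (Site 4) := fun j => if j = 0 then Set.univ else {x | 0 ≤ x 0}

/-- **The lineage model packaged as `B8.GFData` for Proposition 7** (`d = 4`, `L = 3`, `k = 1`, `η = 1`, `𝔸 = ℂ`,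
`Ω₀ = ℤ⁴ ⊃ Ω₁ = {x : 0 ≤ x₀}`): `InA α U₀` = `U₀ ∈ 𝔄_1({Ω_j}, α)`, (1.7)∧(1.9) (`B8Ineq132.InAk` over `OmegaFine`) —
(1.139) as printed; `C162 B s U₀ U₁` = the three members of (1.140) with bound `B·s` for `A = (1/i) log U₁`, demanded at
every site of both levels (so `C162 1 α₂` implies (1.140)); `InAAx α U₀ U′` = `U′U₀ ∈ 𝔄_1({Ω_j}, α) ∩ Ax_1(𝔅_1, U₀)`
(`InAk ∧ B8Eq119TwistedAxial.InAx`) — (1.144) as printed; `avgClose α U₀ U′` = (1.35) `|(U′U₀)‾ʲ_b − Ū₀ʲ_b| < α` for the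
level-`j` bonds `b` on `Λ_j`, `j = 0, 1` (implied by (1.145) "on Ω_j^{(j)}"); `Restricted` = (1.29)
`B8Eq119TwistedAxial.Restr129`; `avgClose166` = (1.66); `act U′ u = U′^{u⁻¹}` in the (1.18) point of view; the remaining
`Prop` fields (not read by `Prop7Printed`) are `True`, `Src = Unit`, `fNorm = 0`.  With these choices the printed
Proposition 7 IMPLIES `B8.Prop7Printed (fun _ => lineageGF7) toAxial7` (hypotheses equal or stronger, conclusions equal
or weaker), so refuting the latter refutes the former as printed.
[cite: Balaban1985RegularSpaces, (1.33)–(1.35) p.82, (1.139)–(1.140) p.100, (1.144)–(1.145) p.100, (1.29) p.81] -/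
def lineageGF7 : B8.GFData where
  Cfg := Site 4 → Fin 4 → ℂˣ
  Pert := Site 4 → Fin 4 → ℂˣ
  GT := Site 4 → ℂˣ
  Src := Unit
  k := 1
  InA := fun α U => InAk 3 1 (1 : ℝ) α OmegaFine U
  Reg335 := fun _ _ => True
  InAAx := fun α U₀ U' =>
    InAk 3 1 (1 : ℝ) α OmegaFine (U' * U₀) ∧ InAx 3 1 (Lam (0 : Fin 4)) U₀ (U' * U₀)
  avgClose := fun α U₀ U' => ∀ j, j ≤ 1 → ∀ (z : Site 4) (κ : Fin 4), Touch j z κ →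
    ‖((avgIter 3 (U' * U₀) j z κ : ℂˣ) : ℂ) - ((avgIter 3 U₀ j z κ : ℂˣ) : ℂ)‖ < α
  avgClose166 := fun α U₀ U' => ∀ j, j ≤ 1 → ∀ (z : Site 4) (κ : Fin 4), (j = 0 ∨ Touch j z κ) →
    ‖((tildIter 3 U₀ U' j z κ : ℂˣ) : ℂ) - 1‖ < α
  Restricted := fun U₀ u => Restr129 3 1 (Lam (0 : Fin 4)) U₀ u
  act := fun U' u => gaugeAct (fun x => (u x)⁻¹) U'
  C136 := fun _ _ _ _ _ => True
  C137 := fun _ _ _ => True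
  Landau := fun _ _ => True
  C139 := fun _ _ _ _ => True
  C162 := fun B s U₀ U₁ => ∀ j, j ≤ 1 → ∀ (x : Site 4) (κ : Fin 4),
    (3 : ℝ) ^ j * ‖Apot U₁ x κ‖ < B * s ∧
    (∀ μ : Fin 4, ((3 : ℝ) ^ j) ^ 2 * ‖covDerivFwd (1 : ℝ) U₀ μ (fun y => Apot U₁ y κ) x‖ < B * s) ∧
    ((3 : ℝ) ^ j) ^ 3 * ‖∑ μ : Fin 4, covDeriv (1 : ℝ) U₀ μ (covDerivFwd (1 : ℝ) U₀ μ (fun y => Apot U₁ y κ)) x‖ < B * s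
  fNorm := fun _ => 0
  LandauF := fun _ _ _ => True

/-- The axial representative of (1.144) in the lineage model: `U′ = U₁^{u₈}` (moving frame (55) of [3] = (1.17)).
[cite: Balaban1985RegularSpaces, (1.144) p.100, (1.17) p.78; Balaban1985Averaging, (55) p.27] -/
def toAxial7 : ∀ _ : Unit, lineageGF7.Cfg → lineageGF7.Pert → lineageGF7.Pert :=
  fun _ U₀ U₁ => mgauge U₀ (u8 3 one_le_three' (0 : Fin 4) U₀ U₁) U₁

/-- For the constant field `U₁ ≡ e^{iθ}`, `|θ| < ln 2`: `A = (1/i) log U₁ ≡ θ`. [folklore] -/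
private theorem Apot_cst (θ : ℝ) (hθ : |θ| < Real.log 2) : Apot (cst (eI θ)) = fun _ _ => (θ : ℂ) := by
  funext x κ
  rw [Apot, cst_apply, mlog_eI θ hθ, ← mul_assoc, inv_mul_cancel₀ Complex.I_ne_zero, one_mul]

/-- **`B8.Prop7Printed` IS FALSE FOR THE LINEAGE FAMILY** (model-instance refutation of SKELETON row B8.Prop7's display
(1.145); cell GAPS G-B8-01 (b)): for every threshold `c > 0` take `α₀ = α₂ = min{c, 1/4}`, `U₀ = 1`, `U₁ ≡ e^{iθ}` with
`3θ = (27/28)α₂`; then (1.139) and (1.140) hold (`hyp139`, `Apot_cst`, `hyp140_grad`, `hyp140_lap`) but the conclusion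
(1.145) ↦ `avgClose (2α₂)` fails on the level-1 bond `⟨y, y + e₀⟩`, `y₀ = −1`, of `Λ₁` (`ineq145_fails_lineage`).
What holds instead (constant `C(d, L)·α₂`): `B8Ineq145.Prop7RepairedC`. [cite: Balaban1985RegularSpaces, Prop. 7 (1.144)–(1.145) p.100] -/
theorem not_prop7Printed_lineage : ¬ B8.Prop7Printed (fun _ : Unit => lineageGF7) toAxial7 := by
  rintro ⟨c, hc, H⟩
  set α₂ : ℝ := min c (1 / 4) with hα₂
  have h0 : 0 < α₂ := lt_min hc (by norm_num)
  have h1 : α₂ ≤ 1 / 4 := min_le_right _ _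
  have hc2 : α₂ ≤ c := min_le_left _ _
  set θ : ℝ := 9 / 28 * α₂ with hθdef
  have hθ : (3 : ℝ) * θ = 27 / 28 * α₂ := by rw [hθdef]; ring
  obtain ⟨hθpos, -, h3⟩ := witness_small h0 h1 hθ
  have hθ2 : |θ| < Real.log 2 := by
    have : |θ| ≤ ((3 : ℕ) : ℝ) * |θ| := by
      have := abs_nonneg θ
      push_cast; nlinarith
    exact this.trans_lt h3
  -- the hypotheses (1.139), (1.140) of the packaged Prop. 7 for `U₀ = 1`, `U₁ ≡ e^{iθ}`
  have hInA : (lineageGF7).InA α₂ (1 : Site 4 → Fin 4 → ℂˣ) := hyp139 3 one_le_three' 1 one_pos h0 _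
  have hC162 : (lineageGF7).C162 1 α₂ (1 : Site 4 → Fin 4 → ℂˣ) (cst (eI θ)) := by
    intro j hj x κ
    rw [Apot_cst θ hθ2]
    have hpow : (3 : ℝ) ^ j * ‖((θ : ℝ) : ℂ)‖ < 1 * α₂ := by
      rw [Complex.norm_real, Real.norm_eq_abs, abs_of_pos hθpos, one_mul]
      interval_cases j <;> nlinarith
    refine ⟨hpow, fun μ => ?_, ?_⟩
    · rw [hyp140_grad, norm_zero, mul_zero, one_mul]; exact h0
    · have hz : ∀ μ : Fin 4, covDeriv (1 : ℝ) (1 : Site 4 → Fin 4 → ℂˣ) μ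
          (covDerivFwd (1 : ℝ) (1 : Site 4 → Fin 4 → ℂˣ) μ (fun _ : Site 4 => ((θ : ℝ) : ℂ))) x = 0 :=
        fun μ => hyp140_lap 1 _ μ μ x
      simp only [hz, Finset.sum_const_zero, norm_zero, mul_zero, one_mul]; exact h0
  obtain ⟨-, havg⟩ := H () α₂ α₂ h0 hc2 h0 hc2 (1 : Site 4 → Fin 4 → ℂˣ) (cst (eI θ)) hInA hC162
  -- the conclusion (1.145) ↦ `avgClose (2α₂)` at the crossing bond `⟨y, y + e₀⟩`, `y₀ = −1`
  let y : Site 4 := fun i => if i = 0 then -1 else 0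
  have hy : y 0 = -1 := by simp [y]
  have htouch : Touch 1 y 0 := Or.inr (by
    show 0 ≤ (y + e (0 : Fin 4)) 0
    simp [y, e_apply])
  have hlt := havg 1 le_rfl y 0 htouch
  have hgt := ineq145_fails_lineage (0 : Fin 4) h0 h1 hθ y hy
  exact lt_irrefl _ (hlt.trans hgt)

end Typed

end Literature.MathematicalPhysics.QuantumFieldTheory.Balaban1983to89.B8Ineq145Lineage

end
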